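import Summits.AtomisticToContinuum.BoseEinsteinCondensation.Theses.BECHusimiAmplitudeGas

/-!
# Birth skeleton for crux `BECHusimiAmplitudeGas.PhaseCapDecay`
(item stmt-AtomisticToContinuum-11990, route route-AtomisticToContinuum-BECHusimiAmplitudeGas;
skeleton registrar planner-skel-stmt-AtomisticToContinuum-11990-0, 2026-08-17; published as
`Cruxes/PhaseCapDecay/Lines/birth.lean`).

Crux (fixed, by name): for admissible `v`, `M ≥ 1`, `ρ < ρ₀(v,M)`, eventually in `N`, some `δ > 0`
and every NONNEGATIVE periodic `δ`-near-minimiser `Ψ` on the torus of side `L = (N/ρ)^{1/3}`, the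
Husimi mass of the ROUGH-PHASE cap `{‖⟨u_c,φ₀⟩‖² ≤ ¾‖c‖² ∧ ⅞‖c‖² < ⟨|u_c|,φ₀⟩²}` is at most `1/8` of
the total Husimi mass `E_w ‖F(u_c)‖²`.

## The cut (the route's own TWO-LAYER PLAN: `PhaseCapDecay ⇐ AmplitudeFloor → PhaseMGFDomination`)

Two named stubs, both load-bearing, neither a restatement of the crux or of the summit:

* `stub_amplitudeFloor` — **anti-hyperuniformity floor of Lieb's amplitude gas** `ν_Ψ = Ψ/∫Ψ`
  (a TWO-POINT statement about the positive near-minimiser, no Husimi object in it): with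
  `S_ν(n) := E_ν |∑_j e^{2πi n·x_j/L}|² / N` the structure factor of `ν_Ψ` at the cube modes
  `0 < |n|_∞ ≤ R = ⌊ML√(ρa)⌋` and `ξ = (8πρa)^{-1/2}` the healing length, there is `c' = c'(v,M) > 0`
  with `S_ν(n) ≥ c'·min(|k_n| ξ, 1)`, `k_n = 2π|n|/L`, uniformly in `N` (i.e. in `L`) at all small
  `ρ` — the twin, for the amplitude gas, of the Bogoliubov/Feynman law `S_μ(k) ≍ |k|ξ` of
  `μ = |Ψ₀|²` (Stringari1995-type floor; amplitude gas: Lieb1963, CarlenJauslinLieb arXiv:1912.04987).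
  Why it might fail: `ν` may be MORE rigid than `μ` at `k ≲ 1/L` (`S_ν/k → 0` kills it).
* `stub_phaseRoughnessDomination` — **Gaussian (MGF) domination of the Husimi phase quadratures,
  first-moment form**: GIVEN the floor at level `c'`, the Husimi-averaged CIRCULAR PHASE VARIANCE
  `ϱ(u_c) := 1 − ‖⟨u_c,φ₀⟩‖²/⟨|u_c|,φ₀⟩² ∈ [0,1]` of the slow field (`= 1 − |E_π e^{iφ}|²`,
  `u_c = |u_c|e^{iφ}`, `π ∝ |u_c|φ₀`) satisfies `E_w[ϱ(u_c)‖F(u_c)‖²] ≤ (1/64)·E_w ‖F(u_c)‖²` for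
  `ρ < ρ₀(v,M,c')`. Heuristic: the phase quadrature `q_k` of mode `k` is dominated by
  `CN(0, C/(N S_ν(k)))`, so `E_H ϱ ≈ ∑_k E_H q_k² ≲ (1/N)∑_{0<|n|≤R} 1/S_ν(n) ≲ C M² √(ρa³)/c'` by the
  floor and the `d = 3` lattice sum — small at small `ρ`. This is a STRONGER conclusion than the
  cap bound (so the crux does not imply it) under an EXTRA hypothesis (so it does not imply the
  crux). Why it might fail: non-Gaussian (cat-like, multimodal) phase statistics of near-minimisers
  at sub-gap `δ`; the refuter's positive cat state `1 + cos(2π∑_j x_{j1}/L)` (evidence on the item)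
  has ideal two-point data yet cap mass `→ 1/3`, so the near-minimiser hypothesis is load-bearing
  and two-point control alone cannot be the whole proof.

## Composition `PhaseCapDecay_of` (sorry-free)

`c'` and `ρ_A` from the floor stub, `ρ_B` from the domination stub at that `c'`, `ρ₀ = min`;
eventually in `N` intersect, `δ = min δ_A δ_B` (a near-minimiser at `min δ` is one at each); the
floor discharges the hypothesis of the domination stub; finally MARKOV on the cap: from the cap
thresholds alone `⟨|u|,φ₀⟩² > ⅞‖c‖² ≥ 0` and `‖⟨u,φ₀⟩‖² ≤ ¾‖c‖²`, so `ϱ > 1 − (¾)(8/7) = 1/7 > 1/8`,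
whence `1_cap ≤ 8ϱ` pointwise and `E_w[1_cap ‖F‖²] ≤ 8·E_w[ϱ‖F‖²] ≤ 8/64·E_w‖F‖² = E_w‖F‖²/8`
(`cap_le_of_moment`, abstract measure-theoretic lemma below, no measurability needed).

Typing note: the stubs bind their abbreviations as `∀ L, L = … → ∀ R, R = … → …` (not `let`), so that
the registered stub signatures are complete one-line terms (the registrar's extractor cuts at the first
`:=`); cube modes are indexed by `n : ℤ³` with `|n_k| ≤ R` in the floor. The composition instantiates
every abbreviation with `rfl`, so the crux's own `let`-bound objects are met definitionally.

Disproof.lean: none exists for this crux yet (`ledger crux ls`: no workfiles) — nothing to honour.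
-/

namespace Summit.AtomisticToContinuum.BoseEinsteinCondensation.Cruxes.PhaseCapDecay.Birth

open scoped BigOperators ENNReal ComplexConjugate
open MeasureTheory Summit.AtomisticToContinuum.BoseEinsteinCondensation.Theses.BECHusimiAmplitudeGas

/-- **Stub A — `AmplitudeFloor`** (layer-2 child named in the route's TWO-LAYER PLAN): the
structure factor of Lieb's amplitude gas `ν_Ψ = Ψ/∫Ψ` of a nonnegative periodic near-minimiser is
bounded below by `c'·min(|k|ξ, 1)` on every nonzero cube mode, `c' = c'(v,M) > 0` uniform in `N`.
[Stringari1995; Lieb1963; arXiv:1912.04987; arXiv:1609.08088] -/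
theorem stub_amplitudeFloor : ∀ v : ℝ → ENNReal, Literature.MathematicalPhysics.QuantumManyBody.BoseGas.IsRepulsiveFiniteRange v → ∀ M : ℝ, 1 ≤ M → ∃ c' : ℝ, 0 < c' ∧ ∃ ρ₀ : ℝ, 0 < ρ₀ ∧ ∀ ρ : ℝ, 0 < ρ → ρ < ρ₀ → ∀ᶠ N : ℕ in Filter.atTop, ∃ δ : ENNReal, 0 < δ ∧ ∀ Ψ : Literature.MathematicalPhysics.QuantumManyBody.BoseGas.PeriodicTrialState N (Literature.MathematicalPhysics.QuantumManyBody.BoseGas.sideLength ρ N), Literature.MathematicalPhysics.QuantumManyBody.BoseGas.periodicEnergy v Ψ ≤ Literature.MathematicalPhysics.QuantumManyBody.BoseGas.periodicGroundStateEnergy v N (Literature.MathematicalPhysics.QuantumManyBody.BoseGas.sideLength ρ N) + δ → (∀ X, Ψ.ψ X = ((‖Ψ.ψ X‖ : ℝ) : ℂ)) → ∀ L : ℝ, L = Literature.MathematicalPhysics.QuantumManyBody.BoseGas.sideLength ρ N → ∀ R : ℕ, R = ⌊M * L * Real.sqrt (ρ * (Literature.MathematicalPhysics.QuantumManyBody.BoseGas.scatteringLength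 v).toReal)⌋₊ → ∀ ξ : ℝ, ξ = (Real.sqrt (8 * Real.pi * ρ * (Literature.MathematicalPhysics.QuantumManyBody.BoseGas.scatteringLength v).toReal))⁻¹ → ∀ S : (Fin 3 → ℤ) → ENNReal, S = (fun n => (∫⁻ X in Literature.MathematicalPhysics.QuantumManyBody.BoseGas.cellN N L, ((‖∑ j, Literature.MathematicalPhysics.QuantumManyBody.BoseGas.cellWave L n (X j)‖₊ : ENNReal) ^ 2) * (‖Ψ.ψ X‖₊ : ENNReal)) / ((N : ENNReal) * ∫⁻ X in Literature.MathematicalPhysics.QuantumManyBody.BoseGas.cellN N L, (‖Ψ.ψ X‖₊ : ENNReal))) → ∀ n : Fin 3 → ℤ, n ≠ 0 → (∀ k, |n k| ≤ (R : ℤ)) → ENNReal.ofReal (c' * min (2 * Real.pi / L * Real.sqrt (∑ k, ((n k : ℝ)) ^ 2) * ξ) 1) ≤ S n := by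
  sorry

/-- **Stub B — `PhaseRoughnessDomination`** (the route's `PhaseMGFDomination`, first-moment
form): given the amplitude-gas floor at level `c'`, the Husimi-averaged circular phase variance
`ϱ(u_c) = 1 − ‖⟨u_c,φ₀⟩‖²/⟨|u_c|,φ₀⟩²` of the slow field of a nonnegative periodic near-minimiser
is at most `1/64` for `ρ < ρ₀(v,M,c')` (MGF domination of the phase quadratures by
`CN(0, C/(N S_ν(k)))` and the `d = 3` lattice sum `(1/N)∑ 1/S_ν ≲ M²√(ρa³)/c'`).
[arXiv:1609.08088; arXiv:1608.07496; Griffin1993; arXiv:math-ph/0412034; arXiv:1409.1182] -/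
theorem stub_phaseRoughnessDomination : ∀ v : ℝ → ENNReal, Literature.MathematicalPhysics.QuantumManyBody.BoseGas.IsRepulsiveFiniteRange v → ∀ M : ℝ, 1 ≤ M → ∀ c' : ℝ, 0 < c' → ∃ ρ₀ : ℝ, 0 < ρ₀ ∧ ∀ ρ : ℝ, 0 < ρ → ρ < ρ₀ → ∀ᶠ N : ℕ in Filter.atTop, ∃ δ : ENNReal, 0 < δ ∧ ∀ Ψ : Literature.MathematicalPhysics.QuantumManyBody.BoseGas.PeriodicTrialState N (Literature.MathematicalPhysics.QuantumManyBody.BoseGas.sideLength ρ N), Literature.MathematicalPhysics.QuantumManyBody.BoseGas.periodicEnergy v Ψ ≤ Literature.MathematicalPhysics.QuantumManyBody.BoseGas.periodicGroundStateEnergy v N (Literature.MathematicalPhysics.QuantumManyBody.BoseGas.sideLength ρ N) + δ → (∀ X, Ψ.ψ X = ((‖Ψ.ψ X‖ : ℝ) : ℂ)) → ∀ L : ℝ, L = Literature.MathematicalPhysics.QuantumManyBody.BoseGas.sideLength ρ N → ∀ R : ℕ, R = ⌊M * L * Real.sqrt (ρ * (Literature.MathematicalPhysics.QuantumManyBody.BoseGas.scatteringLength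 v).toReal)⌋₊ → ∀ ξ : ℝ, ξ = (Real.sqrt (8 * Real.pi * ρ * (Literature.MathematicalPhysics.QuantumManyBody.BoseGas.scatteringLength v).toReal))⁻¹ → ∀ S : (Fin 3 → ℤ) → ENNReal, S = (fun n => (∫⁻ X in Literature.MathematicalPhysics.QuantumManyBody.BoseGas.cellN N L, ((‖∑ j, Literature.MathematicalPhysics.QuantumManyBody.BoseGas.cellWave L n (X j)‖₊ : ENNReal) ^ 2) * (‖Ψ.ψ X‖₊ : ENNReal)) / ((N : ENNReal) * ∫⁻ X in Literature.MathematicalPhysics.QuantumManyBody.BoseGas.cellN N L, (‖Ψ.ψ X‖₊ : ENNReal))) → ∀ e : (Fin 3 → Fin (2 * R + 1)) → Literature.MathematicalPhysics.QuantumManyBody.BoseGas.Space → ℂ, e = (fun i x => Literature.MathematicalPhysics.QuantumManyBody.BoseGas.cellWave L (fun k => ((i k : ℕ) : ℤ) - (R : ℤ)) x / (Real.sqrt (L ^ 3) : ℂ)) → ∀ u : ((Fin 3 → Fin (2 * R + 1)) → ℂ) → Literature.MathematicalPhysics.QuantumManyBody.BoseGas.Space → ℂ, u = (fun c x => ∑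 i, c i * e i x) → ∀ F : (Literature.MathematicalPhysics.QuantumManyBody.BoseGas.Space → ℂ) → ℂ, F = (fun g => ∫ X in Literature.MathematicalPhysics.QuantumManyBody.BoseGas.cellN N L, (∏ j, conj (g (X j))) * Ψ.ψ X) → ∀ ov : (Literature.MathematicalPhysics.QuantumManyBody.BoseGas.Space → ℂ) → ℂ, ov = (fun g => ∫ x in Literature.MathematicalPhysics.QuantumManyBody.BoseGas.cell L, conj (g x) * Literature.MathematicalPhysics.QuantumManyBody.BoseGas.constantMode L x) → ∀ w : ((Fin 3 → Fin (2 * R + 1)) → ℂ) → ENNReal, w = (fun c => ENNReal.ofReal (Real.exp (-(∑ i, ‖c i‖ ^ 2)))) → ∀ ϱ : ((Fin 3 → Fin (2 * R + 1)) → ℂ) → ENNReal, ϱ = (fun c => ENNReal.ofReal ((‖ov (fun x => ((‖u c x‖ : ℝ) : ℂ))‖ ^ 2 - ‖ov (u c)‖ ^ 2) / ‖ov (fun x => ((‖u c x‖ : ℝ) : ℂ))‖ ^ 2)) → (∀ n : Fin 3 → ℤ, n ≠ 0 → (∀ k, |n k| ≤ (R : ℤ)) → ENNReal.ofReal (c'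 * min (2 * Real.pi / L * Real.sqrt (∑ k, ((n k : ℝ)) ^ 2) * ξ) 1) ≤ S n) → (∫⁻ c : (Fin 3 → Fin (2 * R + 1)) → ℂ, w c * ϱ c * ((‖F (u c)‖₊ : ENNReal) ^ 2)) ≤ (1 / 64) * (∫⁻ c : (Fin 3 → Fin (2 * R + 1)) → ℂ, w c * ((‖F (u c)‖₊ : ENNReal) ^ 2)) := by
  sorry

/-- `8 · (1/64) = 1/8` in `ℝ≥0∞`. -/
theorem eight_mul_one_div_sixtyfour : (8 : ℝ≥0∞) * (1 / 64) = 1 / 8 := by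
  rw [ENNReal.div_eq_inv_mul, ENNReal.div_eq_inv_mul, mul_one, mul_one]
  have h64 : (64 : ℝ≥0∞) = 8 * 8 := by norm_num
  rw [h64, ENNReal.mul_inv (Or.inl (by norm_num)) (Or.inl (by norm_num)), ← mul_assoc,
    ENNReal.mul_inv_cancel (by norm_num) (by norm_num), one_mul]

/-- **Markov on the rough-phase cap** (abstract form). If `A ≤ ¾S` and `⅞S < B` with `S ≥ 0`
then `B > 0` and `(B - A)/B > 1/7`, so the cap indicator is `≤ 8·ofReal((B - A)/B)` pointwise; integrate and
use the first-moment bound with constant `1/64`. -/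
theorem cap_le_of_moment {α : Type*} [MeasurableSpace α] {μ : Measure α} {w X : α → ℝ≥0∞}
    {A B S : α → ℝ} [∀ c, Decidable (A c ≤ 3 / 4 * S c ∧ 7 / 8 * S c < B c)]
    (hS : ∀ c, 0 ≤ S c)
    (hmom : ∫⁻ c, w c * ENNReal.ofReal ((B c - A c) / B c) * X c ∂μ ≤ (1 / 64) * ∫⁻ c, w c * X c ∂μ) :
    ∫⁻ c, w c * (if A c ≤ 3 / 4 * S c ∧ 7 / 8 * S c < B c then 1 else 0) * X c ∂μ ≤
      (1 / 8) * ∫⁻ c, w c * X c ∂μ := by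
  have key : ∀ c, w c * (if A c ≤ 3 / 4 * S c ∧ 7 / 8 * S c < B c then 1 else 0) * X c ≤
      8 * (w c * ENNReal.ofReal ((B c - A c) / B c) * X c) := by
    intro c
    split_ifs with h
    · obtain ⟨h1, h2⟩ := h
      have hB : 0 < B c := lt_of_le_of_lt (mul_nonneg (by norm_num) (hS c)) h2
      have hr : (1 : ℝ) ≤ 8 * ((B c - A c) / B c) := by
        rw [← mul_div_assoc, le_div_iff₀ hB]
        nlinarith [hS c, h1, h2]
      have hr' : (1 : ℝ≥0∞) ≤ ENNReal.ofReal (8 * ((B c - A c) / B c)) :=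
        ENNReal.one_le_ofReal.2 hr
      calc w c * 1 * X c = 1 * (w c * X c) := by ring
        _ ≤ ENNReal.ofReal (8 * ((B c - A c) / B c)) * (w c * X c) := by gcongr
        _ = 8 * (w c * ENNReal.ofReal ((B c - A c) / B c) * X c) := by
            rw [ENNReal.ofReal_mul (by norm_num), ENNReal.ofReal_ofNat]; ring
    · simp
  calc ∫⁻ c, w c * (if A c ≤ 3 / 4 * S c ∧ 7 / 8 * S c < B c then 1 else 0) * X c ∂μ
      ≤ ∫⁻ c, 8 * (w c * ENNReal.ofReal ((B c - A c) / B c) * X c) ∂μ := lintegral_mono key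
    _ = 8 * ∫⁻ c, w c * ENNReal.ofReal ((B c - A c) / B c) * X c ∂μ :=
        lintegral_const_mul' _ _ (by norm_num)
    _ ≤ 8 * ((1 / 64) * ∫⁻ c, w c * X c ∂μ) := by gcongr
    _ = (1 / 8) * ∫⁻ c, w c * X c ∂μ := by rw [← mul_assoc, eight_mul_one_div_sixtyfour]

/-- **Composition** — the two stubs imply the crux BY NAME: constants `c'`, `ρ₀ = min ρ_A ρ_B`,
eventual `N` by intersection, `δ = min δ_A δ_B`; the floor (stub A) discharges the hypothesis of
the domination stub (stub B); Markov on the cap (`cap_le_of_moment`) turns the first-moment bound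
`1/64` into the cap-mass bound `1/8`. No `sorry` here. -/
theorem PhaseCapDecay_of : PhaseCapDecay := by
  intro v hv M hM
  obtain ⟨c', hc', ρA, hρA, hA⟩ := stub_amplitudeFloor v hv M hM
  obtain ⟨ρB, hρB, hB⟩ := stub_phaseRoughnessDomination v hv M hM c' hc'
  refine ⟨min ρA ρB, lt_min hρA hρB, fun ρ hρ hρlt => ?_⟩
  have hA' := hA ρ hρ (lt_of_lt_of_le hρlt (min_le_left _ _))
  have hB' := hB ρ hρ (lt_of_lt_of_le hρlt (min_le_right _ _))
  filter_upwards [hA', hB'] with N hNA hNB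
  obtain ⟨δA, hδA, hNA⟩ := hNA
  obtain ⟨δB, hδB, hNB⟩ := hNB
  refine ⟨min δA δB, lt_min hδA hδB, fun Ψ hΨ hpos => ?_⟩
  have hΨA := hΨ.trans (add_le_add le_rfl (min_le_left δA δB))
  have hΨB := hΨ.trans (add_le_add le_rfl (min_le_right δA δB))
  have hfloor := hNA Ψ hΨA hpos _ rfl _ rfl _ rfl _ rfl
  have hmom := hNB Ψ hΨB hpos _ rfl _ rfl _ rfl _ rfl _ rfl _ rfl _ rfl _ rfl _ rfl _ rfl hfloor
  exact cap_le_of_moment (fun c => by positivity) hmom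

end Summit.AtomisticToContinuum.BoseEinsteinCondensation.Cruxes.PhaseCapDecay.Birth
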